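import Summits.BirchSwinnertonDyer.BirchSwinnertonDyer.Theses.DefiniteGrossPeriodAtTwo
import Summits.BirchSwinnertonDyer.BirchSwinnertonDyer.Theorems.DefiniteAnchoredTwistsAtTwoGlue
import HarnessLib

/-!
# SKELETON LINE `anchored_twists` for crux 23667 `OffDefiniteHabitatAtTwo` (route DefiniteGrossPeriodAtTwo, r5, declared residual R)

line-writer skeleton (linewriter-bsd-wide-1 g0); NOT leaf progress. ONE READER for the split of record (LINE 11, rev 5):
the residual R = «BSD₂ for the non-CM analytic-rank ≤ 1 curves off the definite habitat H₃» FOLLOWS from its five gen-1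
children BY NAME — A1 `AnchorPrimitivityAtTwo` (27576, KEY: depth-1 Kolyvagin certificate at 2 for the rank-0 definite
anchor B of a rank-1 twist W ≅ B^(d_K)), A2 `KolyvaginExactAtTwoShifted` (27469, shared GK2 kernel, used at shift t = 0:
#Ш(B/K)[2^∞] = 2^(2M₀)), A3 `MirrorExactDescentAtTwo` (27577, support: BSD₂(B) ∧ exactness over K ∧ exact Gross–Zagier
product ⟹ BSD₂(W)), A4 `DefiniteAnchorBSDTwo` (27578, support: the route's own rank-0 output on H₃), A5
`OffAnchoredTwistResidualAtTwo` (27579, declared residual off the anchored-twist cell) — composed by the LANDED glue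
`offDefiniteHabitatAtTwoOfAnchor_proof` (item 27580, Theorems/DefiniteAnchoredTwistsAtTwoGlue.lean). Strategy for a lead:
attack A1 (census: 347 rank-1 cell curves in Cremona ≤ 5·10⁵, all with even Heegner index c and odd Ш_an — pen LINE11.md /
census-60k.txt on 27576) and A2 at t = 0 (the Δ < 0 twin of GK2's proved-glue halves road, see Lines on 27469); A3/A4 are
bookkeeping over the route's rank-0 cruxes; A5 stays declared. Sorries ONLY inside `stub_*`; nothing asserted.
-/

set_option autoImplicit false

namespace Summit.BirchSwinnertonDyer.BirchSwinnertonDyer.Cruxes.OffDefiniteHabitatAtTwo.AnchoredTwists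

open Summit.BirchSwinnertonDyer.BirchSwinnertonDyer.Theses.DefiniteGrossPeriodAtTwo

/-- [research] stub A1 = item stmt-BirchSwinnertonDyer-27576 `AnchorPrimitivityAtTwo` BY NAME (KEY crux r501; beyond print at 2:
a Kolyvagin prime ℓ with 2 ∥ exponent and P(ℓ) ∉ 2E(K_ℓ) for the rank-0 definite anchor). -/
theorem stub_anchorPrimitivityAtTwo : AnchorPrimitivityAtTwo := by
  sorry

/-- [research] stub A2 = item stmt-BirchSwinnertonDyer-27469 `KolyvaginExactAtTwoShifted` BY NAME (crux r502, shared with GK2;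
consumed here only at shift t = 0: McCallum's structure theorem at p = 2 with m_∞ = 0). -/
theorem stub_kolyvaginExactAtTwoShifted : KolyvaginExactAtTwoShifted := by
  sorry

/-- [support] stub A3 = item stmt-BirchSwinnertonDyer-27577 `MirrorExactDescentAtTwo` BY NAME (support r503: exact descent
K → ℚ across the Gross–Zagier product L(W^K,s) = L(B,s)·L(W,s) with #Ш(B/K)[2^∞] known exactly). -/
theorem stub_mirrorExactDescentAtTwo : MirrorExactDescentAtTwo := by
  sorry

/-- [support] stub A4 = item stmt-BirchSwinnertonDyer-27578 `DefiniteAnchorBSDTwo` BY NAME (support r504: BSD₂ on the definite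
habitat H₃ = the route's rank-0 output, i.e. cruxes 23664–23666 + supply 23668 + descent 23669 restricted to H₃). -/
theorem stub_definiteAnchorBSDTwo : DefiniteAnchorBSDTwo := by
  sorry

/-- [residual] stub A5 = item stmt-BirchSwinnertonDyer-27579 `OffAnchoredTwistResidualAtTwo` BY NAME (declared residual r505:
off the anchored-twist cell; covered by the sibling route ByReductionTypeAtTwo's cells, see Lines on 27579). -/
theorem stub_offAnchoredTwistResidualAtTwo : OffAnchoredTwistResidualAtTwo := by
  sorry

/-- **Composition (kernel-checked): `OffDefiniteHabitatAtTwo`** = the route decl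
`Theses.DefiniteGrossPeriodAtTwo.OffDefiniteHabitatAtTwo` (item 23667) BY NAME, from the five children through the landed
glue `offDefiniteHabitatAtTwoOfAnchor_proof` (item 27580). [cite: Kolyvagin1990Euler] [cite: McCallum1991] [cite: GrossZagier1986] -/
theorem OffDefiniteHabitatAtTwo_of :
    Summit.BirchSwinnertonDyer.BirchSwinnertonDyer.Theses.DefiniteGrossPeriodAtTwo.OffDefiniteHabitatAtTwo :=
  offDefiniteHabitatAtTwoOfAnchor_proof stub_anchorPrimitivityAtTwo stub_kolyvaginExactAtTwoShifted
    stub_mirrorExactDescentAtTwo stub_definiteAnchorBSDTwo stub_offAnchoredTwistResidualAtTwo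

end Summit.BirchSwinnertonDyer.BirchSwinnertonDyer.Cruxes.OffDefiniteHabitatAtTwo.AnchoredTwists
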